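import Summits.QuantumFields.QCD.Theses.SmallBetaInfraredSplit
import Summits.QuantumFields.QCD.Theorems.SmallBetaInfraredSplitZeroCountChessboardCombinatorics
import Literature.MathematicalPhysics.QuantumLattice.StaggeredMasslessDeterminant
import Literature.MathematicalPhysics.StatisticalMechanics.ComplexSpinInfraredBoundProof
import Literature.MathematicalPhysics.StatisticalMechanics.InfraredBoundSpectralStep

/-!
# Route `SmallBetaInfraredSplit` (sub QCD) — aside item `ZeroCountChessboard` (stmt-QuantumFields-23819), PROVED

`TwistedReflectionBound → GaussianDominationSmallBeta` (with `C = 0`, any `β₀`; we take `β₀ = 1`).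

The twisted partition function `Z[g] = exp(−(N/8)‖g‖²) · ∫ Re det(D₀[U] + diag(¼ div g ⊗ 1_N)) dw_β` of a
bond field `g` is continuous (a parametric integral of a jointly continuous integrand over the compact gauge
configuration space against the finite Wilson weight) and tends to `0` at infinity (Hadamard-type bound
`|det M| ≤ n!·(max entry)ⁿ`, polynomial against Gaussian), so the Fröhlich–Simon–Spencer zero-count maximiser
principle (`ZeroCount.le_apply_zero_of_reflection`, part 1 of this item) applies: `TwistedReflectionBound` at the
plane `c = x₀ μ` bisecting a bond `(x₀, μ)` with `g(x₀, μ) ≠ 0` supplies the reflection pair `g₊, g₋` with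
`Z[g]² ≤ Z[g₊]Z[g₋]` and `z(g₊) + z(g₋) ≥ 2 z(g) + 2` (part 1, `two_mul_zeroCount_add_two_le`).  Hence
`|Z[g]| ≤ |Z[0]|`; with `g = 4∇φ` one has `¼ div g = −Δφ` and `(N/8)‖g‖² = 2N(φ,−Δφ)` (summation by parts,
tree `ComplexSpin.sum_sq_link_eq`), which is `GaussianDominationSmallBeta` with constant `(2N)²·(1/N)/2 = 2N`.

HONEST FRAMING: an aside (support) item of a DRAFT-by-design QCD-side line whose cruxes are already closed; the
hypothesis `TwistedReflectionBound` (stmt-QuantumFields-23816) stays OPEN; nothing about `QCD`, `YangMills`, a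
mass gap or a continuum limit is proved here.
[cite: FrohlichSimonSpencer1976, proof of Thm. 2.1; SalmhoferSeiler1991, (3.91)–(3.95)]
-/

set_option autoImplicit false

open MeasureTheory Filter Topology Finset
open Literature.MathematicalPhysics.QuantumFieldTheory
open Literature.MathematicalPhysics.QuantumLattice
open Literature.MathematicalPhysics.StatisticalMechanics
open Literature.Probability.LatticeModels (TorusSite)
open StaggeredSingular (D0 UN)

namespace Summit.QuantumFields.QCD.Theorems.SmallBetaInfraredSplit.ZeroCount

section Model

variable {ν L : ℕ} [NeZero L] (N : ℕ)

/-- The site source `¼ (div g)(x)` (copied on the `N` colours) of `TwistedReflectionBound`.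
[cite: SalmhoferSeiler1991, (3.80)–(3.83)] -/
noncomputable def src (g : TorusSite ν L × Fin ν → ℝ) (i : TorusSite ν L × Fin N) : ℝ :=
  (1 / 4 : ℝ) * ∑ μ' : Fin ν, (g (i.1 - Pi.single μ' 1, μ') - g (i.1, μ'))

/-- The determinant integral `∫ Re det(D₀[U] + diag(¼ div g ⊗ 1_N)) dw_β(U)`.
[cite: SalmhoferSeiler1991, §2 (2.11) and (3.80)] -/
noncomputable def detInt (β : ℝ) (g : TorusSite ν L × Fin ν → ℝ) : ℝ :=
  ∫ U, (Matrix.det (staggeredDirac (unitaryFundamentalRep (Fin N) ℂ) U 0 +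
    Matrix.diagonal (fun i : TorusSite ν L × Fin N => ((src N g i : ℝ) : ℂ)))).re
    ∂(wilsonWeight (d := ν) (L := L) (unitaryFundamentalRep (Fin N) ℂ) β)

/-- The twisted partition function `Z[g] = exp(−(N/8)‖g‖²)·∫ Re det(D₀[U] + diag(¼ div g)) dw_β` of
`TwistedReflectionBound`. [cite: SalmhoferSeiler1991, (3.80)] -/
noncomputable def Zt (β : ℝ) (g : TorusSite ν L × Fin ν → ℝ) : ℝ :=
  Real.exp (-((N : ℝ) / 8) * ∑ b : TorusSite ν L × Fin ν, g b ^ 2) * detInt N β g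

omit [NeZero L] in
/-- The source depends continuously (indeed linearly) on the bond field. [cite: SalmhoferSeiler1991, (3.80)] -/
theorem continuous_src :
    Continuous fun g : TorusSite ν L × Fin ν → ℝ => fun i : TorusSite ν L × Fin N => src N g i :=
  continuous_pi fun _ => continuous_const.mul
    (continuous_finsetSum _ fun _ _ => (continuous_apply _).sub (continuous_apply _))

/-- `|¼ (div g)(x)| ≤ ν‖g‖_∞`. [cite: SalmhoferSeiler1991, (3.80)] -/
theorem abs_src_le (g : TorusSite ν L × Fin ν → ℝ) (i : TorusSite ν L × Fin N) : |src N g i| ≤ ν * ‖g‖ := by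
  unfold src
  rw [abs_mul, abs_of_pos (by norm_num : (0 : ℝ) < 1 / 4)]
  have h : |∑ μ' : Fin ν, (g (i.1 - Pi.single μ' 1, μ') - g (i.1, μ'))| ≤ ∑ _μ' : Fin ν, (‖g‖ + ‖g‖) :=
    (abs_sum_le_sum_abs _ _).trans (sum_le_sum fun μ' _ => (abs_sub _ _).trans
      (add_le_add (by simpa using norm_le_pi_norm g (i.1 - Pi.single μ' 1, μ'))
        (by simpa using norm_le_pi_norm g (i.1, μ'))))
  rw [sum_const, card_univ, Fintype.card_fin, nsmul_eq_mul] at h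
  nlinarith [norm_nonneg g, abs_nonneg (∑ μ' : Fin ν, (g (i.1 - Pi.single μ' 1, μ') - g (i.1, μ')))]

/-- `‖g‖_∞² ≤ Σ_b g_b²`. [folklore] -/
theorem norm_sq_le_sum_sq {ι : Type*} [Fintype ι] (g : ι → ℝ) : ‖g‖ ^ 2 ≤ ∑ b, g b ^ 2 := by
  have hS : 0 ≤ ∑ b, g b ^ 2 := sum_nonneg fun b _ => sq_nonneg (g b)
  have h : ‖g‖ ≤ Real.sqrt (∑ b, g b ^ 2) := by
    refine (pi_norm_le_iff_of_nonneg (Real.sqrt_nonneg _)).2 fun b => ?_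
    rw [Real.norm_eq_abs]
    exact Real.abs_le_sqrt (single_le_sum (fun b _ => sq_nonneg (g b)) (mem_univ b))
  calc ‖g‖ ^ 2 ≤ Real.sqrt (∑ b, g b ^ 2) ^ 2 := pow_le_pow_left₀ (norm_nonneg g) h 2
    _ = ∑ b, g b ^ 2 := Real.sq_sqrt hS

/-- **Continuity of `g ↦ ∫ Re det(D₀[U] + diag(¼ div g)) dw_β`**: a parametric integral of a jointly
continuous integrand over the compact configuration space against a finite measure.
[cite: SalmhoferSeiler1991, §2 (2.11)–(2.12)] -/
theorem continuous_detInt (β : ℝ) : Continuous (detInt (ν := ν) (L := L) N β) := by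
  haveI := StrongCoupling.isFiniteMeasure_wilsonWeight (ν := ν) (L := L) (N := N) β
  have hF : Continuous (Function.uncurry fun (g : TorusSite ν L × Fin ν → ℝ) (U : GaugeConfig ν L (UN N)) =>
      (Matrix.det (D0 U + Matrix.diagonal (fun i : TorusSite ν L × Fin N => ((src N g i : ℝ) : ℂ)))).re) := by
    refine Complex.continuous_re.comp (Continuous.matrix_det (Continuous.add ?_ ?_))
    · exact StaggeredSingular.continuous_D0.comp continuous_snd
    · refine Continuous.matrix_diagonal ?_
      exact (continuous_pi fun i => Complex.continuous_ofReal.comp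
        ((continuous_apply i).comp (continuous_src (ν := ν) (L := L) N))).comp continuous_fst
  have h := continuous_parametric_integral_of_continuous
    (μ := wilsonWeight (d := ν) (L := L) (unitaryFundamentalRep (Fin N) ℂ) β) hF isCompact_univ
  simp only [Measure.restrict_univ] at h
  exact h

/-- `Z[g]` is continuous. [cite: SalmhoferSeiler1991, (3.80)] -/
theorem continuous_Zt (β : ℝ) : Continuous (Zt (ν := ν) (L := L) N β) :=
  (Real.continuous_exp.comp (continuous_const.mul
    (continuous_finsetSum _ fun b _ => (continuous_apply b).pow 2))).mul (continuous_detInt N β)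

/-- The all-zero diagonal matrix vanishes. [folklore] -/
theorem diagonal_const_zero {n : Type*} [Fintype n] [DecidableEq n] :
    Matrix.diagonal (fun _ : n => (0 : ℂ)) = 0 := Matrix.diagonal_zero

/-- The entries of `D₀[U]` are bounded uniformly on the (compact) configuration space.
[cite: SalmhoferSeiler1991, §2 (2.3)] -/
theorem exists_norm_D0_apply_le :
    ∃ K : ℝ, ∀ (U : GaugeConfig ν L (UN N)) (i j : TorusSite ν L × Fin N), ‖D0 U i j‖ ≤ K := by
  have hc : Continuous fun U : GaugeConfig ν L (UN N) =>
      fun p : (TorusSite ν L × Fin N) × (TorusSite ν L × Fin N) => D0 U p.1 p.2 :=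
    continuous_pi fun p => (StaggeredSingular.continuous_D0 (ν := ν) (L := L) (N := N)).matrix_elem p.1 p.2
  obtain ⟨K, hK⟩ := (isCompact_univ (X := GaugeConfig ν L (UN N))).exists_bound_of_continuousOn hc.continuousOn
  exact ⟨K, fun U i j => (norm_le_pi_norm
    (fun p : (TorusSite ν L × Fin N) × (TorusSite ν L × Fin N) => D0 U p.1 p.2) (i, j)).trans
      (hK U (Set.mem_univ U))⟩

/-- **Polynomial bound** `|∫ Re det(D₀[U] + diag(¼ div g)) dw_β| ≤ A·(K + ν‖g‖)ⁿ`: the entries of `D₀[U]` are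
bounded uniformly on the compact configuration space and `|det M| ≤ n!·(max |M_ij|)ⁿ`.
[cite: SalmhoferSeiler1991, §2 (2.11)–(2.12)] -/
theorem exists_abs_detInt_le (β : ℝ) : ∃ K A : ℝ, 0 ≤ K ∧ 0 ≤ A ∧ ∀ g : TorusSite ν L × Fin ν → ℝ,
    |detInt N β g| ≤ A * (K + ν * ‖g‖) ^ Fintype.card (TorusSite ν L × Fin N) := by
  haveI := StrongCoupling.isFiniteMeasure_wilsonWeight (ν := ν) (L := L) (N := N) β
  obtain ⟨K, hK⟩ := exists_norm_D0_apply_le (ν := ν) (L := L) N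
  refine ⟨max K 0, ((Fintype.card (TorusSite ν L × Fin N)).factorial : ℝ) *
      (wilsonWeight (d := ν) (L := L) (unitaryFundamentalRep (Fin N) ℂ) β).real Set.univ,
    le_max_right _ _, by positivity, fun g => ?_⟩
  have hentry : ∀ (U : GaugeConfig ν L (UN N)) (i j : TorusSite ν L × Fin N),
      (IsAbsoluteValue.toAbsoluteValue (norm : ℂ → ℝ))
        ((D0 U + Matrix.diagonal (fun i : TorusSite ν L × Fin N => ((src N g i : ℝ) : ℂ))) i j) ≤
          max K 0 + ν * ‖g‖ := by
    intro U i j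
    show ‖(D0 U + Matrix.diagonal (fun i : TorusSite ν L × Fin N => ((src N g i : ℝ) : ℂ))) i j‖ ≤ _
    have h1 : ‖D0 U i j‖ ≤ max K 0 := (hK U i j).trans (le_max_left _ _)
    have h2 : ‖Matrix.diagonal (fun i : TorusSite ν L × Fin N => ((src N g i : ℝ) : ℂ)) i j‖ ≤ ν * ‖g‖ := by
      rw [Matrix.diagonal_apply]
      split_ifs
      · rw [Complex.norm_real, Real.norm_eq_abs]; exact abs_src_le N g i
      · rw [norm_zero]; positivity
    rw [Matrix.add_apply]
    exact (norm_add_le _ _).trans (add_le_add h1 h2)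
  have hdet : ∀ U : GaugeConfig ν L (UN N),
      ‖(Matrix.det (D0 U + Matrix.diagonal (fun i : TorusSite ν L × Fin N => ((src N g i : ℝ) : ℂ)))).re‖ ≤
        (Fintype.card (TorusSite ν L × Fin N)).factorial * (max K 0 + ν * ‖g‖) ^
          Fintype.card (TorusSite ν L × Fin N) := by
    intro U
    rw [Real.norm_eq_abs]
    refine (Complex.abs_re_le_norm _).trans ?_
    have h := Matrix.det_le (hentry U)
    rw [nsmul_eq_mul] at h
    exact h
  have hint := norm_integral_le_of_norm_le_const
    (μ := wilsonWeight (d := ν) (L := L) (unitaryFundamentalRep (Fin N) ℂ) β) (ae_of_all _ hdet)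
  rw [Real.norm_eq_abs] at hint
  calc |detInt N β g| ≤ (Fintype.card (TorusSite ν L × Fin N)).factorial * (max K 0 + ν * ‖g‖) ^
        Fintype.card (TorusSite ν L × Fin N) *
        (wilsonWeight (d := ν) (L := L) (unitaryFundamentalRep (Fin N) ℂ) β).real Set.univ := hint
    _ = _ := by ring

/-- `|Z[g]| ≤ A (K + ν‖g‖)ⁿ e^{−(N/8)‖g‖²}`. [cite: SalmhoferSeiler1991, (3.80)] -/
theorem exists_abs_Zt_le (β : ℝ) : ∃ K A : ℝ, 0 ≤ K ∧ 0 ≤ A ∧ ∀ g : TorusSite ν L × Fin ν → ℝ,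
    |Zt N β g| ≤ A * (K + ν * ‖g‖) ^ Fintype.card (TorusSite ν L × Fin N) *
      Real.exp (-((N : ℝ) / 8) * ‖g‖ ^ 2) := by
  obtain ⟨K, A, hK, hA, hb⟩ := exists_abs_detInt_le (ν := ν) (L := L) N β
  refine ⟨K, A, hK, hA, fun g => ?_⟩
  unfold Zt
  rw [abs_mul, abs_of_pos (Real.exp_pos _), mul_comm]
  refine mul_le_mul (hb g) (Real.exp_le_exp.2 ?_) (Real.exp_pos _).le (by positivity)
  have := norm_sq_le_sum_sq g
  have hN : (0 : ℝ) ≤ (N : ℝ) / 8 := by positivity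
  nlinarith

/-- The scalar majorant `A (K + c s)ⁿ e^{−κ s²} → 0` as `s → ∞`. [folklore] -/
theorem tendsto_majorant (A K c κ : ℝ) (hA : 0 ≤ A) (hK : 0 ≤ K) (hc : 0 ≤ c) (hκ : 0 < κ) (n : ℕ) :
    Tendsto (fun s : ℝ => A * (K + c * s) ^ n * Real.exp (-κ * s ^ 2)) atTop (𝓝 0) := by
  have h1 : Tendsto (fun s : ℝ => (κ * s) ^ n * Real.exp (-(κ * s))) atTop (𝓝 0) :=
    (Real.tendsto_pow_mul_exp_neg_atTop_nhds_zero n).comp (tendsto_id.const_mul_atTop hκ)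
  have h2 : Tendsto (fun s : ℝ => (A * (K + c) ^ n / κ ^ n) * ((κ * s) ^ n * Real.exp (-(κ * s))))
      atTop (𝓝 0) := by
    simpa using h1.const_mul (A * (K + c) ^ n / κ ^ n)
  refine squeeze_zero' ((eventually_ge_atTop 0).mono fun s hs => by positivity)
    ((eventually_ge_atTop 1).mono fun s hs => ?_) h2
  have hκn : κ ^ n ≠ 0 := pow_ne_zero _ hκ.ne'
  have hpow : (K + c * s) ^ n ≤ (K + c) ^ n * s ^ n := by
    rw [← mul_pow]
    exact pow_le_pow_left₀ (by positivity) (by nlinarith) n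
  have hexp : Real.exp (-κ * s ^ 2) ≤ Real.exp (-(κ * s)) := by
    refine Real.exp_le_exp.2 ?_
    have : κ * s ≤ κ * s ^ 2 := mul_le_mul_of_nonneg_left (by nlinarith) hκ.le
    linarith
  calc A * (K + c * s) ^ n * Real.exp (-κ * s ^ 2)
      ≤ A * ((K + c) ^ n * s ^ n) * Real.exp (-(κ * s)) :=
        mul_le_mul (mul_le_mul_of_nonneg_left hpow hA) hexp (Real.exp_pos _).le (by positivity)
    _ = (A * (K + c) ^ n / κ ^ n) * ((κ * s) ^ n * Real.exp (-(κ * s))) := by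
        rw [mul_pow]; field_simp

/-- **`Z[g] → 0` at infinity** (for `N ≥ 1`). [cite: FrohlichSimonSpencer1976, proof of Thm. 2.1] -/
theorem tendsto_abs_Zt (hN : 1 ≤ N) (β : ℝ) :
    Tendsto (fun g : TorusSite ν L × Fin ν → ℝ => |Zt N β g|) (cocompact _) (𝓝 0) := by
  obtain ⟨K, A, hK, hA, hb⟩ := exists_abs_Zt_le (ν := ν) (L := L) N β
  have hψ := tendsto_majorant A K ν ((N : ℝ) / 8) hA hK (Nat.cast_nonneg ν)
    (by have : (1 : ℝ) ≤ N := by exact_mod_cast hN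
        linarith) (Fintype.card (TorusSite ν L × Fin N))
  exact squeeze_zero' (Eventually.of_forall fun g => abs_nonneg _) (Eventually.of_forall fun g => hb g)
    (hψ.comp tendsto_norm_cocompact_atTop)

end Model

section Final

variable {ν L : ℕ} [NeZero L] (N : ℕ)

omit [NeZero L] in
/-- The base point `x₀` of the bisected bond lies in `Λ₊` (plane `c = x₀ μ`, `L ≥ 2`).
[cite: FrohlichSimonSpencer1976, §2] -/
theorem inPlus_base (μ : Fin ν) (hL2 : 2 ≤ L) (x : TorusSite ν L) : inPlus μ (x μ) x = true := by
  unfold inPlus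
  rw [sub_self, ZMod.val_zero]
  simp only [decide_eq_true_eq]; omega

/-- … and its end point `x₀ + e_μ` lies in `Λ₋`. [cite: FrohlichSimonSpencer1976, §2] -/
theorem inPlus_base_add_single (μ : Fin ν) (hL2 : 2 ≤ L) (x : TorusSite ν L) :
    inPlus μ (x μ) (x + Pi.single μ 1) = false := by
  unfold inPlus
  rw [Pi.add_apply, Pi.single_eq_same, show (x μ - (x μ + 1) : ZMod L) = -1 by ring]
  have hv1 : ((-1 : ZMod L)).val = L - 1 := by
    obtain ⟨k, hk⟩ : ∃ k, L = k + 1 := ⟨L - 1, by omega⟩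
    subst hk
    rw [ZMod.val_neg_one]; rfl
  rw [hv1]
  simp only [decide_eq_false_iff_not, not_lt]; omega

/-- The bond `(x₀, μ)` crosses the plane `c = x₀ μ`. [cite: FrohlichSimonSpencer1976, §2] -/
theorem base_mem_crossSet (hL2 : 2 ≤ L) (x₀ : TorusSite ν L) (μ : Fin ν) :
    (x₀, μ) ∈ crossSet μ (x₀ μ) := by
  rw [mem_crossSet_iff]
  refine ⟨rfl, ?_⟩
  rw [inPlus_base μ hL2, inPlus_base_add_single μ hL2]
  decide

/-- **The reflection pair from `TwistedReflectionBound`**: at the plane `c = x₀ μ` bisecting a bond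
`(x₀, μ)` with `g(x₀, μ) ≠ 0`, `|Z[g]|² ≤ |Z[g₊]|·|Z[g₋]|` and `z(g₊) + z(g₋) ≥ 2 z(g) + 2`.
[cite: FrohlichSimonSpencer1976, proof of Thm. 2.1; SalmhoferSeiler1991, (3.90)–(3.93)] -/
theorem reflection_pair (hT : Summit.QuantumFields.QCD.Theses.SmallBetaInfraredSplit.TwistedReflectionBound)
    (hN : 1 ≤ N) {β : ℝ} (hβ : 0 ≤ β) (hL : Even L) (g : TorusSite ν L × Fin ν → ℝ)
    (b₀ : TorusSite ν L × Fin ν) (hb₀ : g b₀ ≠ 0) :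
    ∃ g₁ g₂ : TorusSite ν L × Fin ν → ℝ, |Zt N β g| ^ 2 ≤ |Zt N β g₁| * |Zt N β g₂| ∧
      2 * zeroCount g + 2 ≤ zeroCount g₁ + zeroCount g₂ := by
  obtain ⟨x₀, μ⟩ := b₀
  have hL2 : 2 ≤ L := by
    obtain ⟨m, hm⟩ := hL
    have := NeZero.ne L
    omega
  refine ⟨tw μ (x₀ μ) g true, tw μ (x₀ μ) g false, ?_,
    two_mul_zeroCount_add_two_le hL g (base_mem_crossSet hL2 x₀ μ) hb₀⟩
  have h : Zt N β g ^ 2 ≤ Zt N β (tw μ (x₀ μ) g true) * Zt N β (tw μ (x₀ μ) g false) :=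
    hT N ν hN β hβ L hL μ (x₀ μ) g
  rw [sq_abs, ← abs_mul]
  exact h.trans (le_abs_self _)

/-- The gradient bond field `g = 4∇φ`. [cite: SalmhoferSeiler1991, (3.82)–(3.83)] -/
def grad (φ : TorusSite ν L → ℝ) (b : TorusSite ν L × Fin ν) : ℝ := 4 * (φ (b.1 + Pi.single b.2 1) - φ b.1)

omit [NeZero L] in
/-- `¼ div(4∇φ) = −Δφ`. [cite: SalmhoferSeiler1991, (3.76), (3.82)–(3.83)] -/
theorem src_grad (φ : TorusSite ν L → ℝ) (i : TorusSite ν L × Fin N) :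
    src N (grad φ) i = -ComplexSpin.laplacian φ i.1 := by
  unfold src grad ComplexSpin.laplacian
  rw [← sum_neg_distrib, mul_sum]
  refine sum_congr rfl fun μ' _ => ?_
  rw [sub_add_cancel]
  ring

omit [NeZero L] in
/-- The source of the zero bond field vanishes. [cite: SalmhoferSeiler1991, (3.80)] -/
theorem src_zero (i : TorusSite ν L × Fin N) : src N (0 : TorusSite ν L × Fin ν → ℝ) i = 0 := by
  simp [src]

/-- `‖4∇φ‖² = 16 (φ, −Δφ)` (summation by parts on the torus). [cite: SalmhoferSeiler1991, (3.76)–(3.77)] -/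
theorem sum_grad_sq (φ : TorusSite ν L → ℝ) :
    ∑ b : TorusSite ν L × Fin ν, grad φ b ^ 2 = 16 * ∑ x, φ x * (-ComplexSpin.laplacian φ x) := by
  have h := ComplexSpin.sum_sq_link_eq (ν := ν) (L := L) (-1) (Or.inr rfl) φ
  simp only [ComplexSpin.stencil_neg_one] at h
  rw [Fintype.sum_prod_type, ← h, mul_sum]
  refine sum_congr rfl fun x _ => ?_
  rw [mul_sum]
  refine sum_congr rfl fun μ _ => ?_
  unfold grad
  ring

/-- A ratio bound from a weighted absolute-value comparison: `e^{-t}|a| ≤ |b| ⟹ a/b ≤ e^{t}` (junk `0` when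
`b = 0`). [folklore] -/
theorem div_le_exp_of_abs_le {a b t : ℝ} (h : Real.exp (-t) * |a| ≤ |b|) :
    a / b ≤ Real.exp t := by
  rcases eq_or_ne b 0 with hb | hb
  · rw [hb, div_zero]; exact (Real.exp_pos t).le
  · calc a / b ≤ |a / b| := le_abs_self _
      _ = |a| / |b| := abs_div a b
      _ ≤ Real.exp t := by
          rw [div_le_iff₀ (abs_pos.2 hb)]
          calc |a| = Real.exp t * (Real.exp (-t) * |a|) := by
                rw [← mul_assoc, ← Real.exp_add, add_neg_cancel, Real.exp_zero, one_mul]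
            _ ≤ Real.exp t * |b| := mul_le_mul_of_nonneg_left h (Real.exp_pos t).le

end Final

end ZeroCount

open ZeroCount

/-- **`ZeroCountChessboard`** (stmt-QuantumFields-23819) BY NAME:
`TwistedReflectionBound → GaussianDominationSmallBeta`, with `β₀ = 1` and `C = 0`.  The zero-count maximiser
principle gives `|Z[4∇φ]| ≤ |Z[0]|`, i.e. `e^{−2N(φ,−Δφ)} |∫ Re det(D₀ + diag(−Δφ))| ≤ |∫ Re det D₀|`, which is the
asserted ratio bound with exponent `(2N)²(1/N + 0·β)(φ,−Δφ)/2 = 2N(φ,−Δφ)`.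
[cite: FrohlichSimonSpencer1976, proof of Thm. 2.1; SalmhoferSeiler1991, (3.91)–(3.95)] -/
theorem zeroCountChessboard_proof :
    Summit.QuantumFields.QCD.Theses.SmallBetaInfraredSplit.ZeroCountChessboard := by
  intro hT N ν hN1 _hN4 _hν
  refine ⟨1, one_pos, 0, le_rfl, fun β hβ _ L _ hL _ φ => ?_⟩
  have hdom : |Zt (ν := ν) (L := L) N β (grad φ)| ≤ |Zt N β 0| :=
    le_apply_zero_of_reflection (fun g => |Zt N β g|) (fun g => abs_nonneg _)
      (continuous_abs.comp (continuous_Zt N β)) (tendsto_abs_Zt N hN1 β)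
      (fun g b hb => reflection_pair N hT hN1 hβ hL g b hb) (grad φ)
  have hD : 0 ≤ ∑ x, φ x * (-ComplexSpin.laplacian φ x) := by
    have h := sum_grad_sq (ν := ν) (L := L) φ
    nlinarith [sum_nonneg fun b (_ : b ∈ (univ : Finset (TorusSite ν L × Fin ν))) => sq_nonneg (grad φ b)]
  simp only [Zt, detInt, src_grad, src_zero, sum_grad_sq, Pi.zero_apply, Complex.ofReal_zero,
    diagonal_const_zero, add_zero, zero_pow two_ne_zero, sum_const_zero, mul_zero, Real.exp_zero,
    one_mul, abs_mul, abs_of_pos (Real.exp_pos _)] at hdom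
  have hexp : (2 * N : ℝ) ^ 2 * (1 / N + 0 * β) * (∑ x, φ x * (-ComplexSpin.laplacian φ x)) / 2 =
      2 * N * ∑ x, φ x * (-ComplexSpin.laplacian φ x) := by
    have hN : (N : ℝ) ≠ 0 := by exact_mod_cast (by omega : N ≠ 0)
    field_simp
    ring
  rw [hexp]
  refine div_le_exp_of_abs_le ?_
  have hrew : -(2 * (N : ℝ) * ∑ x, φ x * (-ComplexSpin.laplacian φ x)) =
      -((N : ℝ) / 8) * (16 * ∑ x, φ x * (-ComplexSpin.laplacian φ x)) := by ring
  rw [hrew]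
  exact hdom

end Summit.QuantumFields.QCD.Theorems.SmallBetaInfraredSplit
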